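import Summits.ResolutionOfSingularities.ResolutionOfSingularities.Theorems.EquisingularLiftEquisingularLiftNatJunctionTransversal
import HarnessLib

/-!
# One-step multiple traces along a transversal `A₁` double curve: `(σ + aτ, τ^m)` is useless, `(σ, τ^m)` separates the sheets

[OURS · L1 W4.5(b)] Helper for the research stub `stub_elnat_three` of the crux `EquisingularLiftNat`
(stmt-ResolutionOfSingularities-20038; route `EquisingularLift`, chain w45b, CRUX-PLAN v3 §1.5 (ii) «(M)
multiples — what is useful»). NOT a statement of any manuscript; AI-written kernel lemma of the cell
`res-hironaka` (weaker than expert review). Kernel form of the plan's hand computation: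
«For transversal type `A₁` (`H = S₁ ∪ S₂` locally, sheets `σ = 0`, `τ = 0`): `Z = (σ + aτ, τ^m)` with `a`
a unit is Cartier on `H` (`τ^m ≡ (σ+aτ)·τ^{m−1}/a mod στ`) ⇒ useless; `Z = (σ, τ^m)` (`m`-structure
inside the sheet `S₁`) is useful: `Bl_{(σ,τ²)}` separates the sheets [computed: `St(S₁) ⊔ St(S₂)`]».

**Setting.** `R` any commutative ring, `𝒪_H = R[σ,τ,w]/(στ)` (`σ, τ, w = X 0, X 1, X 2` of
`MvPolynomial (Fin 3) R`), sheets `S₁ = {σ = 0}`, `S₂ = {τ = 0}`, double curve `Σ = {σ = τ = 0}`.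

**Proved here:**
* `span_X0_inf_span_X1` — `(σ) ∩ (τ) = (στ)` in `R[σ,τ,w]`; `mk_X0_add_C_mul_X1_mem_nonZeroDivisors` —
  `σ̄ + aτ̄` is a non-zero-divisor of `𝒪_H` for a unit `a`;
* `tiltedMultipleTrace_eq_span_singleton` — **`(σ̄ + aτ̄, τ̄^m) = (σ̄ + aτ̄)`** in `𝒪_H` for `m ≥ 2` and
  `a` a unit: the tilted `m`-structure has PRINCIPAL trace generated by a non-zero-divisor (Cartier), so
  blowing it up is an isomorphism on `H` — USELESS;
* `mem_map_span_sigma_iff_pow` — the `τ̄^m`-power torsion of `𝒪_H` is `(σ̄)` (`m ≥ 1`);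
* `sheetMultipleTrace_chart_sigma` / `_chart_taupow` / `_charts_disjoint` / `_charts_cover` — for
  `I = (σ̄, τ̄^m)`, `m ≥ 1`: the chart `D₊(σ̄t)` of `Bl_I H` is `Spec R[σ,τ,w]/(τ) = S₂`, the chart
  `D₊(τ̄^m t)` is `Spec R[σ,τ,w]/(σ) = S₁`, they are disjoint and cover: **`Bl_{(σ,τ^m)} H = S₂ ⊔ S₁`**
  separates the sheets (USEFUL; for `m = 1` this is `Bl_Σ H = H^ν`), by the general `ab = 0` lemmas of
  `…NatJunctionTransversal.lean`.

What is NOT here: the «damage to be priced» of the plan (the singular line of the 4-dimensional total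
space inside `St(S₁)` for the `O`-model of `(σ, τ²)`) and the global obstruction §1.5 (iii) (sheet
monodromy) — both statements about other objects.
References: folklore commutative algebra; The Stacks Project, Tag 0804 (charts of a blowing up).
-/

-- single-problem summit: the doubled namespace component `ResolutionOfSingularities` is forced
set_option linter.dupNamespace false

noncomputable section

open MvPolynomial

namespace Summit.ResolutionOfSingularities.ResolutionOfSingularities.Theorems.EquisingularLift.Junction

universe u

variable {R : Type u} [CommRing R]

open Literature.AlgebraicGeometry.Resolution AlgebraicGeometry

/-- `(σ) ∩ (τ) = (στ)` in `R[σ, τ, w]`. [folklore] -/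
theorem span_X0_inf_span_X1 :
    Ideal.span ({X 0} : Set (MvPolynomial (Fin 3) R)) ⊓ Ideal.span {X 1} = Ideal.span {X 0 * X 1} := by
  apply le_antisymm
  · intro f hf
    obtain ⟨hf0, hf1⟩ := Submodule.mem_inf.mp hf
    obtain ⟨c, rfl⟩ := Ideal.mem_span_singleton'.mp hf0
    -- `c σ ∈ (τ)` ⇒ `c ∈ (τ)`
    have hc : c ∈ Ideal.span ({X 1} : Set (MvPolynomial (Fin 3) R)) :=
      mem_span_X_of_X_mul_mem (i := 1) (j := 0) (by decide) (by rwa [mul_comm] at hf1)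
    obtain ⟨d, rfl⟩ := Ideal.mem_span_singleton'.mp hc
    rw [mul_assoc, mul_comm (X 1)]
    exact Ideal.mul_mem_left _ _ (Ideal.mem_span_singleton_self _)
  · rw [Ideal.span_singleton_le_iff_mem]
    exact Submodule.mem_inf.mpr ⟨Ideal.mul_mem_right _ _ (Ideal.mem_span_singleton_self _),
      Ideal.mul_mem_left _ _ (Ideal.mem_span_singleton_self _)⟩

/-- **`σ̄ + aτ̄` is a non-zero-divisor of `𝒪_H = R[σ,τ,w]/(στ)`** for a unit `a` (it restricts to the
non-zero-divisors `aτ̄` on `S₁` and `σ̄` on `S₂`). [folklore] -/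
theorem mk_X0_add_C_mul_X1_mem_nonZeroDivisors {a : R} (ha : IsUnit a) :
    Ideal.Quotient.mk (Ideal.span {(X 0 * X 1 : MvPolynomial (Fin 3) R)}) (X 0 + C a * X 1) ∈
      nonZeroDivisors (MvPolynomial (Fin 3) R ⧸ Ideal.span {(X 0 * X 1 : MvPolynomial (Fin 3) R)}) := by
  rw [mem_nonZeroDivisors_iff_right]
  intro x hx
  obtain ⟨f, rfl⟩ := Ideal.Quotient.mk_surjective x
  rw [← map_mul, Ideal.Quotient.eq_zero_iff_mem] at hx
  rw [Ideal.Quotient.eq_zero_iff_mem, ← span_X0_inf_span_X1]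
  obtain ⟨b, hb⟩ := ha.exists_left_inv
  -- `f (σ + aτ) ∈ (στ) ⊆ (σ) ∩ (τ)`
  have h0 : f * (X 0 + C a * X 1) ∈ Ideal.span ({X 0} : Set (MvPolynomial (Fin 3) R)) :=
    Ideal.span_singleton_le_span_singleton.mpr (dvd_mul_right _ _) hx
  have h1 : f * (X 0 + C a * X 1) ∈ Ideal.span ({X 1} : Set (MvPolynomial (Fin 3) R)) :=
    Ideal.span_singleton_le_span_singleton.mpr (dvd_mul_left _ _) hx
  refine Submodule.mem_inf.mpr ⟨?_, ?_⟩
  · -- modulo `σ`: `a τ f ∈ (σ)`, so `τ f ∈ (σ)` and `f ∈ (σ)`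
    have h : X 1 * f ∈ Ideal.span ({X 0} : Set (MvPolynomial (Fin 3) R)) := by
      have hba : (C b * C a : MvPolynomial (Fin 3) R) = 1 := by rw [← C_mul, hb, C_1]
      have e : X 1 * f = C b * (f * (X 0 + C a * X 1)) - (C b * f) * X 0 := by
        linear_combination (-(X 1 * f)) * hba
      rw [e]
      exact Ideal.sub_mem _ (Ideal.mul_mem_left _ _ h0)
        (Ideal.mul_mem_left _ _ (Ideal.mem_span_singleton_self _))
    exact mem_span_X_of_X_mul_mem (i := 0) (j := 1) (by decide) h
  · -- modulo `τ`: `σ f ∈ (τ)`, so `f ∈ (τ)`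
    have h : X 0 * f ∈ Ideal.span ({X 1} : Set (MvPolynomial (Fin 3) R)) := by
      have e : X 0 * f = f * (X 0 + C a * X 1) - (C a * f) * X 1 := by ring
      rw [e]
      exact Ideal.sub_mem _ h1 (Ideal.mul_mem_left _ _ (Ideal.mem_span_singleton_self _))
    exact mem_span_X_of_X_mul_mem (i := 1) (j := 0) (by decide) h

/-- **Tilted multiples are useless.** In `𝒪_H = R[σ,τ,w]/(στ)`, for a unit `a` and `m ≥ 2`:
`(σ̄ + aτ̄, τ̄^m) = (σ̄ + aτ̄)` (as `τ^m ≡ a⁻¹ τ^{m-1} (σ + aτ) mod στ`), a principal ideal generated by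
a non-zero-divisor (`mk_X0_add_C_mul_X1_mem_nonZeroDivisors`): the trace is Cartier, so its blow-up is
an isomorphism on `H`. [folklore] -/
theorem tiltedMultipleTrace_eq_span_singleton {a : R} (ha : IsUnit a) {m : ℕ} (hm : 2 ≤ m) :
    Ideal.span {Ideal.Quotient.mk (Ideal.span {(X 0 * X 1 : MvPolynomial (Fin 3) R)}) (X 0 + C a * X 1),
        Ideal.Quotient.mk (Ideal.span {(X 0 * X 1 : MvPolynomial (Fin 3) R)}) (X 1 ^ m)} =
      Ideal.span {Ideal.Quotient.mk (Ideal.span {(X 0 * X 1 : MvPolynomial (Fin 3) R)})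
        (X 0 + C a * X 1)} := by
  obtain ⟨n, rfl⟩ := Nat.exists_eq_add_of_le hm
  obtain ⟨b, hb⟩ := ha.exists_left_inv
  apply le_antisymm
  · rw [Ideal.span_le]
    rintro x hx
    simp only [Set.mem_insert_iff, Set.mem_singleton_iff] at hx
    rcases hx with rfl | rfl
    · exact Ideal.mem_span_singleton_self _
    · -- `τ^{n+2} = b τ^{n+1} (σ + aτ) - b τ^n (στ)`
      rw [SetLike.mem_coe, Ideal.mem_span_singleton']
      refine ⟨Ideal.Quotient.mk _ (C b * X 1 ^ (n + 1)), ?_⟩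
      rw [← map_mul, Ideal.Quotient.mk_eq_mk_iff_sub_mem, Ideal.mem_span_singleton']
      refine ⟨C b * X 1 ^ n, ?_⟩
      have hba : (C b * C a : MvPolynomial (Fin 3) R) = 1 := by rw [← C_mul, hb, C_1]
      linear_combination (-(X 1 ^ (n + 2))) * hba
  · exact Ideal.span_mono (Set.singleton_subset_iff.mpr (Set.mem_insert _ _))

/-- The `τ̄^m`-power torsion of `𝒪_H` (`m ≥ 1`) is `(σ̄)`, the ideal of the sheet `S₁`. [folklore] -/
theorem mem_map_span_sigma_iff_pow {m : ℕ} (hm : 1 ≤ m)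
    (x : MvPolynomial (Fin 3) R ⧸ Ideal.span {(X 0 * X 1 : MvPolynomial (Fin 3) R)}) :
    x ∈ (Ideal.span {(X 0 : MvPolynomial (Fin 3) R)}).map
        (Ideal.Quotient.mk (Ideal.span {(X 0 * X 1 : MvPolynomial (Fin 3) R)})) ↔
      ∃ n : ℕ, (Ideal.Quotient.mk (Ideal.span {(X 0 * X 1 : MvPolynomial (Fin 3) R)}) (X 1 ^ m)) ^ n * x = 0 := by
  obtain ⟨m, rfl⟩ := Nat.exists_eq_add_of_le hm
  obtain ⟨x, rfl⟩ := Ideal.Quotient.mk_surjective x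
  rw [Ideal.map_span, Set.image_singleton]
  constructor
  · intro hx
    obtain ⟨c, hc⟩ := Ideal.mem_span_singleton'.mp hx
    obtain ⟨c, rfl⟩ := Ideal.Quotient.mk_surjective c
    refine ⟨1, ?_⟩
    rw [pow_one, ← hc, ← map_mul, ← map_mul, Ideal.Quotient.eq_zero_iff_mem,
      show (X 1 ^ (1 + m) * (c * X 0) : MvPolynomial (Fin 3) R) = (c * X 1 ^ m) * (X 0 * X 1) by ring]
    exact Ideal.mul_mem_left _ _ (Ideal.mem_span_singleton_self _)
  · rintro ⟨n, hn⟩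
    rw [← map_pow, ← map_mul, Ideal.Quotient.eq_zero_iff_mem, ← pow_mul] at hn
    have hsub : Ideal.span {(X 0 * X 1 : MvPolynomial (Fin 3) R)} ≤
        Ideal.span {(X 0 : MvPolynomial (Fin 3) R)} :=
      Ideal.span_singleton_le_span_singleton.mpr (dvd_mul_right _ _)
    have hx' := mem_span_X_of_X_pow_mul_mem (R := R) (i := 0) (j := 1) (by decide) _ (hsub hn)
    obtain ⟨c, hc⟩ := Ideal.mem_span_singleton'.mp hx'
    exact Ideal.mem_span_singleton'.mpr ⟨Ideal.Quotient.mk _ c, by rw [← hc, map_mul]⟩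

/-- **Chart `D₊(σ̄t)` of `Bl_{(σ,τ^m)} H` is the sheet `S₂ = {τ = 0}`** (`m ≥ 1`): the affine blowup
algebra `𝒪_H[I/σ̄]`, `I = (σ̄, τ̄^m)`, is `R[σ,τ,w]/(τ)` over `𝒪_H`. [folklore] -/
theorem sheetMultipleTrace_chart_sigma {m : ℕ} (hm : 1 ≤ m)
    (I : Ideal (MvPolynomial (Fin 3) R ⧸ Ideal.span {(X 0 * X 1 : MvPolynomial (Fin 3) R)}))
    (hI : I = Ideal.span {Ideal.Quotient.mk _ (X 0), Ideal.Quotient.mk _ (X 1 ^ m)}) :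
    ∃ e : blowupAlgebra I (Ideal.Quotient.mk (Ideal.span {(X 0 * X 1 : MvPolynomial (Fin 3) R)}) (X 0)) ≃+*
        (MvPolynomial (Fin 3) R ⧸ Ideal.span {(X 1 : MvPolynomial (Fin 3) R)}),
      ∀ x : MvPolynomial (Fin 3) R,
        e (algebraMap (MvPolynomial (Fin 3) R ⧸ Ideal.span {(X 0 * X 1 : MvPolynomial (Fin 3) R)}) _
          (Ideal.Quotient.mk (Ideal.span {(X 0 * X 1 : MvPolynomial (Fin 3) R)}) x)) =
        Ideal.Quotient.mk (Ideal.span {(X 1 : MvPolynomial (Fin 3) R)}) x := by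
  obtain ⟨m, rfl⟩ := Nat.exists_eq_add_of_le hm
  have hab : Ideal.Quotient.mk (Ideal.span {(X 0 * X 1 : MvPolynomial (Fin 3) R)}) (X 0) *
      Ideal.Quotient.mk (Ideal.span {(X 0 * X 1 : MvPolynomial (Fin 3) R)}) (X 1 ^ (1 + m)) = 0 := by
    rw [← map_mul, Ideal.Quotient.eq_zero_iff_mem,
      show (X 0 * X 1 ^ (1 + m) : MvPolynomial (Fin 3) R) = X 1 ^ m * (X 0 * X 1) by ring]
    exact Ideal.mul_mem_left _ _ (Ideal.mem_span_singleton_self _)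
  obtain ⟨e₁, he₁⟩ := exists_ringEquiv_blowupAlgebra_of_eq_bot _
    (blowupAlgebra_eq_bot_of_mul_eq_zero hab hI)
  have hker := ker_algebraMap_away_eq _ _ (mem_map_span_tau_iff (R := R))
  have hsup : Ideal.span {(X 0 * X 1 : MvPolynomial (Fin 3) R)} ⊔ Ideal.span {X 1} =
      Ideal.span {X 1} :=
    sup_eq_right.mpr (Ideal.span_singleton_le_span_singleton.mpr (dvd_mul_left _ _))
  let e₂ := (Ideal.quotEquivOfEq hker).trans
    ((DoubleQuot.quotQuotEquivQuotSup (Ideal.span {(X 0 * X 1 : MvPolynomial (Fin 3) R)})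
      (Ideal.span {(X 1 : MvPolynomial (Fin 3) R)})).trans (Ideal.quotEquivOfEq hsup))
  refine ⟨e₁.symm.trans e₂, fun x => ?_⟩
  rw [RingEquiv.trans_apply, ← he₁, RingEquiv.symm_apply_apply]
  change Ideal.quotEquivOfEq hsup (DoubleQuot.quotQuotEquivQuotSup _ _
    (Ideal.quotEquivOfEq hker (Ideal.Quotient.mk _ (Ideal.Quotient.mk _ x)))) = _
  rw [Ideal.quotEquivOfEq_mk]
  have h2 : DoubleQuot.quotQuotEquivQuotSup (Ideal.span {(X 0 * X 1 : MvPolynomial (Fin 3) R)})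
      (Ideal.span {(X 1 : MvPolynomial (Fin 3) R)}) (Ideal.Quotient.mk _ (Ideal.Quotient.mk _ x)) =
      Ideal.Quotient.mk _ x :=
    DoubleQuot.quotQuotEquivQuotSup_quotQuotMk _ _ x
  rw [h2, Ideal.quotEquivOfEq_mk]

/-- **Chart `D₊(τ̄^m t)` of `Bl_{(σ,τ^m)} H` is the sheet `S₁ = {σ = 0}`** (`m ≥ 1`): the affine blowup
algebra `𝒪_H[I/τ̄^m]` is `R[σ,τ,w]/(σ)` over `𝒪_H`. [folklore] -/
theorem sheetMultipleTrace_chart_taupow {m : ℕ} (hm : 1 ≤ m)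
    (I : Ideal (MvPolynomial (Fin 3) R ⧸ Ideal.span {(X 0 * X 1 : MvPolynomial (Fin 3) R)}))
    (hI : I = Ideal.span {Ideal.Quotient.mk _ (X 0), Ideal.Quotient.mk _ (X 1 ^ m)}) :
    ∃ e : blowupAlgebra I (Ideal.Quotient.mk (Ideal.span {(X 0 * X 1 : MvPolynomial (Fin 3) R)}) (X 1 ^ m)) ≃+*
        (MvPolynomial (Fin 3) R ⧸ Ideal.span {(X 0 : MvPolynomial (Fin 3) R)}),
      ∀ x : MvPolynomial (Fin 3) R,
        e (algebraMap (MvPolynomial (Fin 3) R ⧸ Ideal.span {(X 0 * X 1 : MvPolynomial (Fin 3) R)}) _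
          (Ideal.Quotient.mk (Ideal.span {(X 0 * X 1 : MvPolynomial (Fin 3) R)}) x)) =
        Ideal.Quotient.mk (Ideal.span {(X 0 : MvPolynomial (Fin 3) R)}) x := by
  have hba : Ideal.Quotient.mk (Ideal.span {(X 0 * X 1 : MvPolynomial (Fin 3) R)}) (X 1 ^ m) *
      Ideal.Quotient.mk (Ideal.span {(X 0 * X 1 : MvPolynomial (Fin 3) R)}) (X 0) = 0 := by
    obtain ⟨m, rfl⟩ := Nat.exists_eq_add_of_le hm
    rw [← map_mul, Ideal.Quotient.eq_zero_iff_mem,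
      show (X 1 ^ (1 + m) * X 0 : MvPolynomial (Fin 3) R) = X 1 ^ m * (X 0 * X 1) by ring]
    exact Ideal.mul_mem_left _ _ (Ideal.mem_span_singleton_self _)
  have hI' : I = Ideal.span {Ideal.Quotient.mk _ (X 1 ^ m), Ideal.Quotient.mk _ (X 0)} := by
    rw [hI, Ideal.span_pair_comm]
  obtain ⟨e₁, he₁⟩ := exists_ringEquiv_blowupAlgebra_of_eq_bot _
    (blowupAlgebra_eq_bot_of_mul_eq_zero hba hI')
  have hker := ker_algebraMap_away_eq _ _ (mem_map_span_sigma_iff_pow (R := R) hm)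
  have hsup : Ideal.span {(X 0 * X 1 : MvPolynomial (Fin 3) R)} ⊔ Ideal.span {X 0} =
      Ideal.span {X 0} :=
    sup_eq_right.mpr (Ideal.span_singleton_le_span_singleton.mpr (dvd_mul_right _ _))
  let e₂ := (Ideal.quotEquivOfEq hker).trans
    ((DoubleQuot.quotQuotEquivQuotSup (Ideal.span {(X 0 * X 1 : MvPolynomial (Fin 3) R)})
      (Ideal.span {(X 0 : MvPolynomial (Fin 3) R)})).trans (Ideal.quotEquivOfEq hsup))
  refine ⟨e₁.symm.trans e₂, fun x => ?_⟩
  rw [RingEquiv.trans_apply, ← he₁, RingEquiv.symm_apply_apply]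
  change Ideal.quotEquivOfEq hsup (DoubleQuot.quotQuotEquivQuotSup _ _
    (Ideal.quotEquivOfEq hker (Ideal.Quotient.mk _ (Ideal.Quotient.mk _ x)))) = _
  rw [Ideal.quotEquivOfEq_mk]
  have h2 : DoubleQuot.quotQuotEquivQuotSup (Ideal.span {(X 0 * X 1 : MvPolynomial (Fin 3) R)})
      (Ideal.span {(X 0 : MvPolynomial (Fin 3) R)}) (Ideal.Quotient.mk _ (Ideal.Quotient.mk _ x)) =
      Ideal.Quotient.mk _ x :=
    DoubleQuot.quotQuotEquivQuotSup_quotQuotMk _ _ x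
  rw [h2, Ideal.quotEquivOfEq_mk]

/-- **The two charts of `Bl_{(σ,τ^m)} H` are disjoint** (`σ̄ τ̄^m = 0`): the `m`-structure inside the
sheet SEPARATES the sheets. [folklore] -/
theorem sheetMultipleTrace_charts_disjoint {m : ℕ} (hm : 1 ≤ m)
    (I : Ideal (MvPolynomial (Fin 3) R ⧸ Ideal.span {(X 0 * X 1 : MvPolynomial (Fin 3) R)}))
    (ha : Ideal.Quotient.mk (Ideal.span {(X 0 * X 1 : MvPolynomial (Fin 3) R)}) (X 0) ∈ I)
    (hb : Ideal.Quotient.mk (Ideal.span {(X 0 * X 1 : MvPolynomial (Fin 3) R)}) (X 1 ^ m) ∈ I) :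
    Proj.basicOpen (reesGrading I) (reesT _ ha) ⊓ Proj.basicOpen (reesGrading I) (reesT _ hb) = ⊥ := by
  refine basicOpen_inf_basicOpen_eq_bot_of_mul_eq_zero ?_ ha hb
  obtain ⟨m, rfl⟩ := Nat.exists_eq_add_of_le hm
  rw [← map_mul, Ideal.Quotient.eq_zero_iff_mem,
    show (X 0 * X 1 ^ (1 + m) : MvPolynomial (Fin 3) R) = X 1 ^ m * (X 0 * X 1) by ring]
  exact Ideal.mul_mem_left _ _ (Ideal.mem_span_singleton_self _)

/-- **The two charts cover `Bl_{(σ,τ^m)} H`**; with the chart computations and disjointness: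
`Bl_{(σ,τ^m)} H = S₂ ⊔ S₁` — the useful multiple resolves the `A₁` double curve exactly like `Bl_Σ`.
[folklore] -/
theorem sheetMultipleTrace_charts_cover {m : ℕ}
    (I : Ideal (MvPolynomial (Fin 3) R ⧸ Ideal.span {(X 0 * X 1 : MvPolynomial (Fin 3) R)}))
    (hI : I = Ideal.span {Ideal.Quotient.mk _ (X 0), Ideal.Quotient.mk _ (X 1 ^ m)})
    (ha : Ideal.Quotient.mk (Ideal.span {(X 0 * X 1 : MvPolynomial (Fin 3) R)}) (X 0) ∈ I)
    (hb : Ideal.Quotient.mk (Ideal.span {(X 0 * X 1 : MvPolynomial (Fin 3) R)}) (X 1 ^ m) ∈ I) :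
    Proj.basicOpen (reesGrading I) (reesT _ ha) ⊔ Proj.basicOpen (reesGrading I) (reesT _ hb) = ⊤ :=
  basicOpen_sup_basicOpen_eq_top_of_span_pair hI ha hb

end Summit.ResolutionOfSingularities.ResolutionOfSingularities.Theorems.EquisingularLift.Junction

end
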